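import Summits.HubbardSuperconductivity.HubbardSuperconductivity.Theses.AposterioriCapRg

/-!
# `B₁g` unit vectors exist on every torus of side `L ≥ 2`
# (helper for crux `CapRgSymmetricCertificatePinned`, item stmt-HubbardSuperconductivity-14045, route AposterioriCapRg)

Non-vacuity of the `B₁g` index types of the crux's Cooper clauses: `CooperDominance` (clause (ii′) of
`SymmetricCertifiedAtT`) asks for a UNIT `B₁g` vector attaining the bottom of the Cooper matrix, and the strict
isotypic-gap clause (G) of the lines `strict-continuum-certificate-transfer` / `loewner-riccati-channel-sandwich`
takes an infimum over the subtype `{f // star f ⬝ᵥ f = 1 ∧ IsB1g f}`.  Disproof.lean §6 (cdisprove) shows that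
subtype is EMPTY at side `1` (so `L₀ ≥ 2` is forced).  Here, conversely: from side `2` on it is inhabited — the
tree's own `d`-wave symbol `dWaveSymbol L k = 2√2 (cos p₀ - cos p₁)` is `B₁g` for the tree's `d4Site`/`b1gChar`
and does not vanish at `k = (1, 0)`, so its normalisation is a unit `B₁g` vector (`exists_unit_isB1g`,
`nonempty_unit_isB1g`).  Sorry-free positive helper written by refuter drefute-stmt-HubbardSuperconductivity-14045-0
(crux workfile `DrefuteB1gWitness.lean`, evidence `B1gWitness.lean` 2026-08-16T05:08Z, "prover/lead to land"),
landed verbatim (namespace moved under the line's) by lead seat c2 as support of the crux item.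
-/

noncomputable section

namespace Summit.HubbardSuperconductivity.CapRgSymmetricCertificatePinned.B1gWitness

open Literature.MathematicalPhysics.QuantumLattice Literature.Probability.LatticeModels Matrix
open scoped BigOperators ComplexConjugate

variable {L : ℕ}

/-- The `d`-wave symbol is odd under the rotation by `π/2`. -/
theorem dWaveSymbol_rotSite [NeZero L] (k : TorusSite 2 L) :
    dWaveSymbol L (rotSite k) = -dWaveSymbol L k := by
  have h0 : latticeMomentum L (rotSite k) 0 = latticeMomentum L (-k) 1 := by
    simp [latticeMomentum, rotSite]
  have h1 : latticeMomentum L (rotSite k) 1 = latticeMomentum L k 0 := by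
    simp [latticeMomentum, rotSite]
  rw [dWaveSymbol, dWaveSymbol, h0, h1, cos_latticeMomentum_neg]
  ring

/-- The `d`-wave symbol is even under the axis reflection. -/
theorem dWaveSymbol_reflSite [NeZero L] (k : TorusSite 2 L) :
    dWaveSymbol L (reflSite k) = dWaveSymbol L k := by
  have h0 : latticeMomentum L (reflSite k) 0 = latticeMomentum L k 0 := by
    simp [latticeMomentum, reflSite]
  have h1 : latticeMomentum L (reflSite k) 1 = latticeMomentum L (-k) 1 := by
    simp [latticeMomentum, reflSite]
  rw [dWaveSymbol, dWaveSymbol, h0, h1, cos_latticeMomentum_neg]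

/-- Iterated rotations: `φ_d(rot^n k) = (-1)^n φ_d(k)`. -/
theorem dWaveSymbol_rotSite_iterate [NeZero L] (n : ℕ) (k : TorusSite 2 L) :
    dWaveSymbol L (rotSite^[n] k) = (-1) ^ n * dWaveSymbol L k := by
  induction n generalizing k with
  | zero => simp
  | succ n ih =>
    rw [Function.iterate_succ_apply', dWaveSymbol_rotSite, ih]
    ring

/-- **The `d`-wave symbol is `B₁g`** for the tree's `D₄` action `d4Site` and character `b1gChar`. -/
theorem isB1g_dWaveSymbol [NeZero L] : IsB1g (fun k : TorusSite 2 L => (dWaveSymbol L k : ℂ)) := by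
  intro γ k
  cases γ with
  | r i =>
    simp only [d4Site, b1gChar]
    rw [dWaveSymbol_rotSite_iterate]
    push_cast
    ring
  | sr i =>
    simp only [d4Site, b1gChar]
    rw [dWaveSymbol_reflSite, dWaveSymbol_rotSite_iterate]
    push_cast
    ring

/-- On a torus of side `L ≥ 2` the `d`-wave symbol does not vanish at `k = (1, 0)`:
`φ_d = 2√2 (cos(2π/L) - 1) ≠ 0`. -/
theorem dWaveSymbol_one_zero_ne_zero (hL : 2 ≤ L) :
    haveI : NeZero L := ⟨by omega⟩
    dWaveSymbol L ![(1 : ZMod L), 0] ≠ 0 := by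
  haveI : NeZero L := ⟨by omega⟩
  haveI : Fact (1 < L) := ⟨by omega⟩
  have hval : ((![(1 : ZMod L), 0] : TorusSite 2 L) 0).val = 1 := by
    simp [ZMod.val_one]
  have hval1 : ((![(1 : ZMod L), 0] : TorusSite 2 L) 1).val = 0 := by
    simp
  have hLpos : (0 : ℝ) < L := by exact_mod_cast (show 0 < L by omega)
  have hcos : Real.cos (2 * Real.pi * (1 : ℝ) / L) ≠ 1 := by
    intro h
    have hlt1 : -(2 * Real.pi) < 2 * Real.pi * (1 : ℝ) / L := by
      have : 0 < 2 * Real.pi * (1 : ℝ) / L := by positivity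
      linarith [Real.pi_pos]
    have hlt2 : 2 * Real.pi * (1 : ℝ) / L < 2 * Real.pi := by
      rw [div_lt_iff₀ hLpos]
      have hL2 : (2 : ℝ) ≤ L := by exact_mod_cast hL
      nlinarith [Real.pi_pos]
    have h0 := (Real.cos_eq_one_iff_of_lt_of_lt hlt1 hlt2).1 h
    have : 0 < 2 * Real.pi * (1 : ℝ) / L := by positivity
    linarith
  unfold dWaveSymbol latticeMomentum
  rw [hval, hval1]
  simp only [Nat.cast_one, Nat.cast_zero, mul_zero, zero_div, Real.cos_zero]
  have h22 : (2 : ℝ) * Real.sqrt 2 ≠ 0 := by positivity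
  intro h
  rcases mul_eq_zero.1 h with h1 | h1
  · exact h22 h1
  · exact hcos (by linarith)

/-- **From side `2` on there is a unit `B₁g` vector** (the normalised `d`-wave symbol), so the
subtypes `{f // star f ⬝ᵥ f = 1 ∧ IsB1g f}` indexing the isotypic-gap clause of `C⁺` and the witness of
`CooperDominance` are inhabited, and the `⨅` over them is an honest infimum rather than the junk `0`. -/
theorem exists_unit_isB1g (hL : 2 ≤ L) :
    haveI : NeZero L := ⟨by omega⟩
    ∃ f : TorusSite 2 L → ℂ, star f ⬝ᵥ f = 1 ∧ IsB1g f := by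
  haveI : NeZero L := ⟨by omega⟩
  set φ : TorusSite 2 L → ℝ := fun k => dWaveSymbol L k with hφ
  set c : ℝ := ∑ k, φ k ^ 2 with hc
  have hcpos : 0 < c := by
    have hk := dWaveSymbol_one_zero_ne_zero hL
    have : 0 < φ ![(1 : ZMod L), 0] ^ 2 := by positivity
    exact lt_of_lt_of_le this (Finset.single_le_sum (f := fun k => φ k ^ 2) (fun k _ => sq_nonneg _)
      (Finset.mem_univ _))
  set s : ℝ := (Real.sqrt c)⁻¹ with hs
  refine ⟨fun k => ((s * φ k : ℝ) : ℂ), ?_, ?_⟩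
  · -- normalisation
    have hsum : star (fun k => ((s * φ k : ℝ) : ℂ)) ⬝ᵥ (fun k => ((s * φ k : ℝ) : ℂ)) =
        ((∑ k, (s * φ k) ^ 2 : ℝ) : ℂ) := by
      simp only [dotProduct, Pi.star_apply, Complex.star_def, Complex.conj_ofReal]
      push_cast
      refine Finset.sum_congr rfl fun k _ => ?_
      ring
    rw [hsum]
    have : ∑ k, (s * φ k) ^ 2 = s ^ 2 * c := by
      rw [hc, Finset.mul_sum]
      refine Finset.sum_congr rfl fun k _ => ?_
      ring
    rw [this, hs, inv_pow, Real.sq_sqrt hcpos.le, inv_mul_cancel₀ hcpos.ne']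
    simp
  · -- B₁g (homogeneity of the transformation law)
    intro γ k
    have h := isB1g_dWaveSymbol (L := L) γ k
    simp only [hφ] at h ⊢
    push_cast
    rw [h]
    ring

/-- Hence the natural quantity in `C⁺`'s clause (G), the infimum of the Rayleigh quotient over unit
`B₁g` vectors, is bounded by an honest Rayleigh value from side `2` on (the index type is nonempty). -/
theorem nonempty_unit_isB1g (hL : 2 ≤ L) :
    haveI : NeZero L := ⟨by omega⟩
    Nonempty {f : TorusSite 2 L → ℂ // star f ⬝ᵥ f = 1 ∧ IsB1g f} := by
  obtain ⟨f, hf⟩ := exists_unit_isB1g hL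
  exact ⟨⟨f, hf⟩⟩

/-- **Registered form** (stub `stub_existsUnitIsB1g` of crux item stmt-HubbardSuperconductivity-14045): on every torus
of side `L ≥ 2` there is a unit vector of symmetry `B₁g` — the index types of `CooperDominance` and of the
isotypic-gap clause (G) are inhabited from side `2` on. -/
theorem stub_existsUnitIsB1g : ∀ L : ℕ, 2 ≤ L → ∀ [NeZero L], ∃ f : TorusSite 2 L → ℂ, star f ⬝ᵥ f = 1 ∧ IsB1g f :=
  fun _ hL _ => exists_unit_isB1g hL

end Summit.HubbardSuperconductivity.CapRgSymmetricCertificatePinned.B1gWitness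

end
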